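import Summits.NavierStokesRegularity.FunctionalMining.TopEigDensityLine
import Summits.NavierStokesRegularity.FunctionalMining.TopEigSelectionBound
import Summits.NavierStokesRegularity.FunctionalMining.BiaxialXRay
import Literature.Analysis.FunctionSpaces.TorusEnstrophyOrthogonality
import HarnessLib

/-!
# FunctionalMining — the density identity on the torus: gradient, channels and Laplacian of an
# eigenvalue of the strain along a smooth eigenpair (F1 PART I, Proposition 3)

Search for candidate a priori estimates; no regularity claim. Cell `pub-nsfunc`, prove seat
(gen 22). Torus assembly of the one-parameter eigenpair calculus of `TopEigDensityLine.lean`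
(F1 PART I PROPOSITION 3; pen, countersigned in the cell — not a cited fact). Let `v` be a smooth
field on `T^d`, `S = sym ∇v` (`torusStrainMatrix`), and let `(μ, e)` be a SMOOTH GLOBAL EIGENPAIR:
`S(y) e(y) = μ(y) e(y)`, `|e(y)| = 1` for all `y` (the existence of such a pair where `λ₁` is simple
is the implicit-function step of Prop. 3 and is NOT done here; the identities below are what it is
used for). Writing `∂ₖe` for the vector of partial derivatives of the components of `e`:

* `TopEig.partialDeriv_eigenvalue`: `∂ₖ μ = eᵀ S(∂ₖv) e` (`S` commutes with `∂ₖ`);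
* `TopEig.eigenpair_channel_partialDeriv`: `(∂ₖe)ᵀ S(∂ₖv) e = μ |∂ₖe|² − (∂ₖe)ᵀ S (∂ₖe)`, and
  **`TopEig.eigenpair_channel_partialDeriv_nonneg`**: `≥ 0` wherever `e(x)` is a top vector of
  `S(x)` — the rotation/tilt channels of SIEVELD's density (1) are non-negative, inverse-free;
* `TopEig.partialDeriv_partialDeriv_eigenvalue`: `∂ₖ∂ₖ μ = eᵀ S(∂ₖ∂ₖv) e + 2 (∂ₖe)ᵀ S(∂ₖv) e`;
* **`TopEig.laplacian_eigenvalue`** (PROPOSITION 3 on `T^d`):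
  `Δμ = eᵀ S(Δv) e + 2 ∑ₖ (μ |∂ₖe|² − (∂ₖe)ᵀ S ∂ₖe)`, i.e. the density seen by `e`,
  `−q μ^{q−1} eᵀΔS e`, is `2q μ^{q−1} ∑ₖ(channels) − q μ^{q−1} Δμ`; with `Δ(μ^q) = q(q−1)μ^{q−2}|∇μ|²
  + q μ^{q−1} Δμ` this is identity (2) of F1 PART I (`ρ_e = F_q − Δ(λ₁^q)`).

Tools: `hasDerivAt_coordLine` (derivative along `t ↦ x + t eₖ` = `∂ₖ` at the moved point),
`partialDeriv_strainEntry` (`∂ₖ Sᵢⱼ(v) = Sᵢⱼ(∂ₖv)`, from the tree's `partialDeriv_twoStrain`), `torusStrainMatrix_laplacian`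
(`∑ₖ S(∂ₖ∂ₖv) = S(Δv)`). Static calculus on the flat torus; nothing about Navier–Stokes dynamics.
[ours; folklore]
-/

noncomputable section

open MeasureTheory Set Filter Topology Matrix

namespace Summit.NavierStokesRegularity.FunctionalMining

open Literature.Analysis Literature.Analysis.FunctionSpaces Literature.Analysis.FunctionSpaces.Torus
  Literature.Analysis.FluidPDE

namespace TopEig

variable {d : Type*} [Fintype d] [DecidableEq d]
variable {v : UnitAddTorus d → EuclideanSpace ℝ d}

/-! ## 1. Coordinate lines and the strain entries -/

/-- Derivative along the coordinate line `t ↦ x + t eₖ` of a smooth function: the partial derivative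
`∂ₖ f` at the moved point. [folklore] -/
theorem hasDerivAt_coordLine {F : Type*} [NormedAddCommGroup F] [NormedSpace ℝ F]
    {f : UnitAddTorus d → F} (hf : Torus.IsSmooth f) (x : UnitAddTorus d) (k : d) (t : ℝ) :
    HasDerivAt (fun s : ℝ => f (x + proj (s • EuclideanSpace.single k (1 : ℝ))))
      (Torus.partialDeriv k f (x + proj (t • EuclideanSpace.single k (1 : ℝ)))) t := by
  rw [partialDeriv_eq_fderiv_apply (hf.isContDiff (by simp)) k]
  exact BiaxialEikonal.hasDerivAt_line hf x _ t

omit [Fintype d] [DecidableEq d] in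
/-- The coordinate line passes through `x` at `t = 0`. [folklore] -/
theorem coordLine_zero (x : UnitAddTorus d) (K : EuclideanSpace ℝ d) : x + proj ((0 : ℝ) • K) = x := by
  rw [zero_smul, proj_zero, add_zero]

/-- The strain entries of a smooth field are smooth. [folklore] -/
theorem isSmooth_torusStrainMatrix_entry (hv : Torus.IsSmooth v) (i j : d) :
    Torus.IsSmooth (fun y => torusStrainMatrix v y i j) :=
  GradientTensor.isSmooth_strainEntry hv i j

/-- **`∂ₖ Sᵢⱼ(v) = Sᵢⱼ(∂ₖ v)`**: the strain commutes with partial derivatives (mixed partials of a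
smooth field commute). [folklore] -/
theorem partialDeriv_strainEntry (hv : Torus.IsSmooth v) (k i j : d) (y : UnitAddTorus d) :
    Torus.partialDeriv k (fun x => torusStrainMatrix v x i j) y =
      torusStrainMatrix (Torus.partialDeriv k v) y i j := by
  have hc : ∀ l m : d, Torus.IsContDiff 1 (fun x => Torus.partialDeriv l v x m) :=
    fun l m => ((hv.partialDeriv l).apply m).isContDiff (by simp)
  have hc2 : Torus.IsContDiff 1 (fun x => Torus.partialDeriv j v x i + Torus.partialDeriv i v x j) :=
    (hc j i).add (hc i j)
  have hfun : (fun x => torusStrainMatrix v x i j) =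
      (1 / 2 : ℝ) • (fun x => Torus.partialDeriv j v x i + Torus.partialDeriv i v x j) := by
    funext x
    simp only [BiaxialEikonal.torusStrainMatrix_apply, Pi.smul_apply, smul_eq_mul]
    ring
  rw [hfun, Torus.partialDeriv_const_smul hc2 (1 / 2 : ℝ), Pi.smul_apply, smul_eq_mul,
    BiaxialEikonal.partialDeriv_twoStrain hv k i j y, BiaxialEikonal.torusStrainMatrix_apply]
  ring

/-- The flattened strain is the flattening of the strain matrix. [ours, bookkeeping] -/
theorem flat_torusStrainMatrix (v : UnitAddTorus d → EuclideanSpace ℝ d) (x : UnitAddTorus d) :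
    SharpClass.DirectorForm.flat (torusStrainMatrix v x) = StrainL4.strainFlat v x := by
  ext p
  rfl

/-- **`∑ₖ S(∂ₖ∂ₖ v) = S(Δv)`** entrywise. [folklore] -/
theorem torusStrainMatrix_laplacian (hv : Torus.IsSmooth v) (x : UnitAddTorus d) (i j : d) :
    ∑ k, torusStrainMatrix (Torus.partialDeriv k (Torus.partialDeriv k v)) x i j =
      torusStrainMatrix (Torus.laplacian v) x i j := by
  have h1 : torusStrainMatrix (Torus.laplacian v) x i j = StrainL4.strainFlat (Torus.laplacian v) x (i, j) := by
    simp [StrainL4.strainFlat_apply, BiaxialEikonal.torusStrainMatrix_apply]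
  have h2 : StrainL4.strainFlat (Torus.laplacian v) x (i, j) =
      Torus.laplacian (fun y => torusStrainMatrix v y i j) x := by
    rw [strainFlat_laplacian hv x]
    have h := Torus.laplacian_clm_comp_apply (StrainL4.isSmooth_strainFlat hv)
      (EuclideanSpace.proj (i, j) : EuclideanSpace ℝ (d × d) →L[ℝ] ℝ) x
    have hfun : ((EuclideanSpace.proj (i, j) : EuclideanSpace ℝ (d × d) →L[ℝ] ℝ) ∘ StrainL4.strainFlat v) =
        fun y => torusStrainMatrix v y i j := by
      funext y
      simp [StrainL4.strainFlat_apply, BiaxialEikonal.torusStrainMatrix_apply]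
    rw [hfun] at h
    rw [h]
    rfl
  rw [h1, h2, Torus.laplacian_eq_sum_partialDeriv_partialDeriv (isSmooth_torusStrainMatrix_entry hv i j)]
  refine Finset.sum_congr rfl fun k _ => ?_
  have hk : Torus.partialDeriv k (fun y => torusStrainMatrix v y i j) =
      fun y => torusStrainMatrix (Torus.partialDeriv k v) y i j :=
    funext (partialDeriv_strainEntry hv k i j)
  rw [hk, partialDeriv_strainEntry (hv.partialDeriv k) k i j x]

/-! ## 2. A smooth global eigenpair: smoothness of the eigenvalue, the line data -/

section Eigenpair

variable {e : UnitAddTorus d → d → ℝ} {μ : UnitAddTorus d → ℝ}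

/-- The eigenvalue of a smooth unit eigenpair is the Rayleigh quotient `eᵀSe`, hence smooth.
[folklore] -/
theorem isSmooth_eigenvalue (hv : Torus.IsSmooth v) (he : ∀ i, Torus.IsSmooth (fun y => e y i))
    (heig : ∀ y, torusStrainMatrix v y *ᵥ e y = μ y • e y) (hunit : ∀ y, e y ⬝ᵥ e y = 1) :
    Torus.IsSmooth μ := by
  have hμ : μ = fun y => ∑ i, ∑ j, e y i * torusStrainMatrix v y i j * e y j := by
    funext y
    rw [← dotProduct_mulVec_eq_sum_sum, heig y, dotProduct_smul, hunit y, smul_eq_mul, mul_one]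
  rw [hμ]
  have h : ∀ i j, Torus.IsSmooth (fun y => e y i * torusStrainMatrix v y i j * e y j) := fun i j =>
    ContDiff.mul (ContDiff.mul (he i) (isSmooth_torusStrainMatrix_entry hv i j)) (he j)
  unfold Torus.IsSmooth at h ⊢
  exact ContDiff.sum fun i _ => ContDiff.sum fun j _ => h i j

/-- **`∂ₖ μ = eᵀ S(∂ₖ v) e`** (Hellmann–Feynman on the torus; F1 PART I Prop. 3,
`∂ₖλ₁ = ⟨e₁, ∂ₖS e₁⟩`). [folklore] -/
theorem partialDeriv_eigenvalue (hv : Torus.IsSmooth v) (he : ∀ i, Torus.IsSmooth (fun y => e y i))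
    (heig : ∀ y, torusStrainMatrix v y *ᵥ e y = μ y • e y) (hunit : ∀ y, e y ⬝ᵥ e y = 1)
    (k : d) (x : UnitAddTorus d) :
    Torus.partialDeriv k μ x = e x ⬝ᵥ (torusStrainMatrix (Torus.partialDeriv k v) x *ᵥ e x) := by
  set K : EuclideanSpace ℝ d := EuclideanSpace.single k (1 : ℝ) with hK
  have hA : ∀ i j, HasDerivAt (fun t : ℝ => torusStrainMatrix v (x + proj (t • K)) i j)
      (torusStrainMatrix (Torus.partialDeriv k v) x i j) 0 := by
    intro i j
    have h := hasDerivAt_coordLine (isSmooth_torusStrainMatrix_entry hv i j) x k 0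
    rw [coordLine_zero, partialDeriv_strainEntry hv] at h
    exact h
  have hE : ∀ i, HasDerivAt (fun t : ℝ => e (x + proj (t • K)) i)
      (Torus.partialDeriv k (fun y => e y i) x) 0 := by
    intro i
    have h := hasDerivAt_coordLine (he i) x k 0
    rw [coordLine_zero] at h
    exact h
  have hHF := hasDerivAt_eigenvalue_line (μ := fun t : ℝ => μ (x + proj (t • K))) hA hE
    (by rw [coordLine_zero]; exact torusStrainMatrix_isSymm v x)
    (Eventually.of_forall fun t => heig _) (Eventually.of_forall fun t => hunit _)
  rw [coordLine_zero] at hHF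
  exact hHF.deriv

/-- **The channel identity on the torus**: `(∂ₖe)ᵀ S(∂ₖv) e = μ |∂ₖe|² − (∂ₖe)ᵀ S (∂ₖe)` at every
point, `∂ₖe` the vector of partial derivatives of the components of `e`. [folklore; F1 PART I Prop. 3] -/
theorem eigenpair_channel_partialDeriv (hv : Torus.IsSmooth v)
    (he : ∀ i, Torus.IsSmooth (fun y => e y i))
    (heig : ∀ y, torusStrainMatrix v y *ᵥ e y = μ y • e y) (hunit : ∀ y, e y ⬝ᵥ e y = 1)
    (k : d) (x : UnitAddTorus d) :
    (fun i => Torus.partialDeriv k (fun y => e y i) x) ⬝ᵥ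
        (torusStrainMatrix (Torus.partialDeriv k v) x *ᵥ e x) =
      μ x * ((fun i => Torus.partialDeriv k (fun y => e y i) x) ⬝ᵥ
          (fun i => Torus.partialDeriv k (fun y => e y i) x)) -
        (fun i => Torus.partialDeriv k (fun y => e y i) x) ⬝ᵥ
          (torusStrainMatrix v x *ᵥ fun i => Torus.partialDeriv k (fun y => e y i) x) := by
  set K : EuclideanSpace ℝ d := EuclideanSpace.single k (1 : ℝ) with hK
  have hA : ∀ i j, HasDerivAt (fun t : ℝ => torusStrainMatrix v (x + proj (t • K)) i j)
      (torusStrainMatrix (Torus.partialDeriv k v) x i j) 0 := by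
    intro i j
    have h := hasDerivAt_coordLine (isSmooth_torusStrainMatrix_entry hv i j) x k 0
    rw [coordLine_zero, partialDeriv_strainEntry hv] at h
    exact h
  have hE : ∀ i, HasDerivAt (fun t : ℝ => e (x + proj (t • K)) i)
      (Torus.partialDeriv k (fun y => e y i) x) 0 := by
    intro i
    have h := hasDerivAt_coordLine (he i) x k 0
    rw [coordLine_zero] at h
    exact h
  have h := eigenpair_channel_eq (μ := fun t : ℝ => μ (x + proj (t • K)))
    (e' := fun i => Torus.partialDeriv k (fun y => e y i) x) hA hE
    (by rw [coordLine_zero]; exact torusStrainMatrix_isSymm v x)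
    (Eventually.of_forall fun t => heig _) (Eventually.of_forall fun t => hunit _)
  rw [coordLine_zero] at h
  exact h

/-- **The channels are non-negative at a top vector (torus form).** If `e(x)` is a top vector of
`S(x)` (`e x ∈ E(S(x))`), then `(∂ₖe)ᵀ S(∂ₖv) e (x) = (∂ₖe)ᵀ(λ₁ − S)(∂ₖe) ≥ 0` for every `k`: the
rotation and tilt channels of SIEVELD's density are non-negative, with no inverse and no simplicity
hypothesis. [ours; F1 PART I (1), Prop. 3] -/
theorem eigenpair_channel_partialDeriv_nonneg (hv : Torus.IsSmooth v)
    (he : ∀ i, Torus.IsSmooth (fun y => e y i))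
    (heig : ∀ y, torusStrainMatrix v y *ᵥ e y = μ y • e y) (hunit : ∀ y, e y ⬝ᵥ e y = 1)
    (k : d) {x : UnitAddTorus d} (htop : e x ∈ topEigSet (StrainL4.strainFlat v x)) :
    0 ≤ (fun i => Torus.partialDeriv k (fun y => e y i) x) ⬝ᵥ
        (torusStrainMatrix (Torus.partialDeriv k v) x *ᵥ e x) := by
  set K : EuclideanSpace ℝ d := EuclideanSpace.single k (1 : ℝ) with hK
  have hA : ∀ i j, HasDerivAt (fun t : ℝ => torusStrainMatrix v (x + proj (t • K)) i j)
      (torusStrainMatrix (Torus.partialDeriv k v) x i j) 0 := by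
    intro i j
    have h := hasDerivAt_coordLine (isSmooth_torusStrainMatrix_entry hv i j) x k 0
    rw [coordLine_zero, partialDeriv_strainEntry hv] at h
    exact h
  have hE : ∀ i, HasDerivAt (fun t : ℝ => e (x + proj (t • K)) i)
      (Torus.partialDeriv k (fun y => e y i) x) 0 := by
    intro i
    have h := hasDerivAt_coordLine (he i) x k 0
    rw [coordLine_zero] at h
    exact h
  have h := eigenpair_channel_nonneg_of_top (μ := fun t : ℝ => μ (x + proj (t • K)))
    (e' := fun i => Torus.partialDeriv k (fun y => e y i) x) hA hE
    (by rw [coordLine_zero]; exact torusStrainMatrix_isSymm v x)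
    (Eventually.of_forall fun t => heig _) (Eventually.of_forall fun t => hunit _)
    (by rw [coordLine_zero, flat_torusStrainMatrix]; exact htop)
  rw [coordLine_zero] at h
  exact h

/-- **`∂ₖ∂ₖ μ = eᵀ S(∂ₖ∂ₖ v) e + 2 (∂ₖe)ᵀ S(∂ₖ v) e`** (second derivative of the eigenvalue along a
coordinate direction). [folklore; F1 PART I Prop. 3] -/
theorem partialDeriv_partialDeriv_eigenvalue (hv : Torus.IsSmooth v)
    (he : ∀ i, Torus.IsSmooth (fun y => e y i))
    (heig : ∀ y, torusStrainMatrix v y *ᵥ e y = μ y • e y) (hunit : ∀ y, e y ⬝ᵥ e y = 1)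
    (k : d) (x : UnitAddTorus d) :
    Torus.partialDeriv k (Torus.partialDeriv k μ) x =
      e x ⬝ᵥ (torusStrainMatrix (Torus.partialDeriv k (Torus.partialDeriv k v)) x *ᵥ e x) +
        2 * ((fun i => Torus.partialDeriv k (fun y => e y i) x) ⬝ᵥ
          (torusStrainMatrix (Torus.partialDeriv k v) x *ᵥ e x)) := by
  set K : EuclideanSpace ℝ d := EuclideanSpace.single k (1 : ℝ) with hK
  have hμs : Torus.IsSmooth μ := isSmooth_eigenvalue hv he heig hunit
  -- line data at every time
  have hA : ∀ᶠ t in 𝓝 (0 : ℝ), ∀ i j, HasDerivAt (fun s : ℝ => torusStrainMatrix v (x + proj (s • K)) i j)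
      (torusStrainMatrix (Torus.partialDeriv k v) (x + proj (t • K)) i j) t :=
    Eventually.of_forall fun t i j => by
      have h := hasDerivAt_coordLine (isSmooth_torusStrainMatrix_entry hv i j) x k t
      rw [partialDeriv_strainEntry hv] at h
      exact h
  have hA' : ∀ i j, HasDerivAt
      (fun t : ℝ => torusStrainMatrix (Torus.partialDeriv k v) (x + proj (t • K)) i j)
      (torusStrainMatrix (Torus.partialDeriv k (Torus.partialDeriv k v)) x i j) 0 := by
    intro i j
    have h := hasDerivAt_coordLine (isSmooth_torusStrainMatrix_entry (hv.partialDeriv k) i j) x k 0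
    rw [coordLine_zero, partialDeriv_strainEntry (hv.partialDeriv k)] at h
    exact h
  have hEt : ∀ᶠ t in 𝓝 (0 : ℝ), ∀ i, DifferentiableAt ℝ (fun s : ℝ => e (x + proj (s • K)) i) t :=
    Eventually.of_forall fun t i => (hasDerivAt_coordLine (he i) x k t).differentiableAt
  have hE : ∀ i, HasDerivAt (fun t : ℝ => e (x + proj (t • K)) i)
      (Torus.partialDeriv k (fun y => e y i) x) 0 := by
    intro i
    have h := hasDerivAt_coordLine (he i) x k 0
    rw [coordLine_zero] at h
    exact h
  obtain ⟨-, -, h2⟩ := hasDerivAt_deriv_eigenvalue_line (μ := fun t : ℝ => μ (x + proj (t • K)))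
    hA hA' hEt hE (Eventually.of_forall fun t => torusStrainMatrix_isSymm v _)
    (Eventually.of_forall fun t => heig _) (Eventually.of_forall fun t => hunit _)
  -- the derivative of the line function of `μ` is the line function of `∂ₖ μ`
  have hder : deriv (fun t : ℝ => μ (x + proj (t • K))) =
      fun t => Torus.partialDeriv k μ (x + proj (t • K)) :=
    funext fun t => (hasDerivAt_coordLine hμs x k t).deriv
  rw [hder, coordLine_zero] at h2
  exact h2.deriv

/-- **PROPOSITION 3 on the torus (Laplacian of the eigenvalue).** For a smooth field `v` on `T^d`
and a smooth global unit eigenpair `S e = μ e`: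
`Δμ(x) = e(x)ᵀ S(Δv)(x) e(x) + 2 ∑ₖ (μ |∂ₖe|² − (∂ₖe)ᵀ S (∂ₖe))(x)`.
Where `e(x)` is a top vector every summand is `≥ 0` (`eigenpair_channel_partialDeriv_nonneg`), so
the density seen by `e`, `−q μ^{q−1} eᵀ ΔS e = 2q μ^{q−1} ∑ₖ(channels) − q μ^{q−1} Δμ`, is a
non-negative channel sum minus `q μ^{q−1}Δμ`; with the chain rule
`Δ(μ^q) = q(q−1) μ^{q−2} |∇μ|² + q μ^{q−1} Δμ` this is F1 PART I (2), `ρ_e = F_q − Δ(λ₁^q)`.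
[ours; F1 PART I Prop. 3] -/
theorem laplacian_eigenvalue (hv : Torus.IsSmooth v) (he : ∀ i, Torus.IsSmooth (fun y => e y i))
    (heig : ∀ y, torusStrainMatrix v y *ᵥ e y = μ y • e y) (hunit : ∀ y, e y ⬝ᵥ e y = 1)
    (x : UnitAddTorus d) :
    Torus.laplacian μ x =
      e x ⬝ᵥ (torusStrainMatrix (Torus.laplacian v) x *ᵥ e x) +
        2 * ∑ k, (μ x * ((fun i => Torus.partialDeriv k (fun y => e y i) x) ⬝ᵥ
            (fun i => Torus.partialDeriv k (fun y => e y i) x)) -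
          (fun i => Torus.partialDeriv k (fun y => e y i) x) ⬝ᵥ
            (torusStrainMatrix v x *ᵥ fun i => Torus.partialDeriv k (fun y => e y i) x)) := by
  have hμs : Torus.IsSmooth μ := isSmooth_eigenvalue hv he heig hunit
  rw [Torus.laplacian_eq_sum_partialDeriv_partialDeriv hμs x]
  simp_rw [partialDeriv_partialDeriv_eigenvalue hv he heig hunit _ x,
    eigenpair_channel_partialDeriv hv he heig hunit _ x]
  rw [Finset.sum_add_distrib, ← Finset.mul_sum]
  congr 1
  -- `∑ₖ eᵀ S(∂ₖ∂ₖv) e = eᵀ S(Δv) e`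
  simp_rw [dotProduct_mulVec_eq_sum_sum]
  rw [Finset.sum_comm]
  refine Finset.sum_congr rfl fun i _ => ?_
  rw [Finset.sum_comm]
  refine Finset.sum_congr rfl fun j _ => ?_
  rw [← torusStrainMatrix_laplacian hv x i j, Finset.mul_sum, Finset.sum_mul]

/-- The same with the flattened strain of the cell's `T`-calculus: the density seen by `e`,
`eᵀ ΔS(x) e = quad (strainFlat (Δv) x) (e x)`, equals `Δμ(x) − 2 ∑ₖ(channels)(x)`. [ours] -/
theorem quad_strainFlat_laplacian_eq (hv : Torus.IsSmooth v) (he : ∀ i, Torus.IsSmooth (fun y => e y i))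
    (heig : ∀ y, torusStrainMatrix v y *ᵥ e y = μ y • e y) (hunit : ∀ y, e y ⬝ᵥ e y = 1)
    (x : UnitAddTorus d) :
    quad (StrainL4.strainFlat (Torus.laplacian v) x) (e x) =
      Torus.laplacian μ x -
        2 * ∑ k, (μ x * ((fun i => Torus.partialDeriv k (fun y => e y i) x) ⬝ᵥ
            (fun i => Torus.partialDeriv k (fun y => e y i) x)) -
          (fun i => Torus.partialDeriv k (fun y => e y i) x) ⬝ᵥ
            (torusStrainMatrix v x *ᵥ fun i => Torus.partialDeriv k (fun y => e y i) x)) := by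
  rw [laplacian_eigenvalue hv he heig hunit x, ← flat_torusStrainMatrix, SharpClass.DirectorForm.quad_flat]
  ring

end Eigenpair

end TopEig

end Summit.NavierStokesRegularity.FunctionalMining

end
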